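import Mathlib
import Summits.NavierStokesRegularity.NavierStokesRegularity.Theorems.EulerZoomLiouvillePowerGaugeEulerLiouvilleSelfSimilarTopBadNodeLandscape
import HarnessLib.Audit

/-!
# Rung C1 of the crux `EulerZoomLiouville.PowerGaugeEulerLiouville`: the INTEGRATED landscape inequality along a backward
# trajectory near the top bad node (inventory item (iii) of the no-exit lemma)

Route №10 `EulerZoomLiouville` (NavierStokesRegularity), crux E = stmt-NavierStokesRegularity-19832,
tenure rung C1 (exactly self-similar members), registered residue `stub_selfSimilarExtremal`.
Nineteenth file of the NODAL-CONTINUUM line (lineage ns-typeII-p1, gen 7).  Setting of `…TopBadNodeLandscape`: a `C²` profile,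
`z` with `curl U(z) = 0`, a unit `e`, a graph curve `Γ(τ) = z + τe + g(τ)` (`g ⊥ e`) with `V(Γ τ) = φ(τ)e` for `|τ| ≤ δ`, and a
backward trajectory `Y` whose kernel coordinate `σ(t) = ⟪e, Y(t) − z⟫` stays in `[−δ, δ]` on `[0, t₁]`.

* `selfSimilarBernoulli_graph_gain` — **`ℋ(Γ(σ(t₁))) − ℋ(Γ(σ(0))) ≥ ∫₀^{t₁} [ (1−2γ)/4·φ(σ)² − 3(1−2γ)/4·x² ] dt`**, where
  `x(t) := ⟪e, V(Y t)⟫ − φ(σ t)` is the kernel component of the linearisation error (`|x| ≤ ρ|ξ|` in the tube) and the commutator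
  smallness `2‖DU(Γτ) − DU(z)‖·‖e + g′(τ)‖ ≤ (1−2γ)/2` holds for `|τ| ≤ δ` (true near `z`): the projected Bernoulli value climbs by
  the squared drift, up to the squared kernel error (`hasDerivAt_selfSimilarBernoulli_graph`, `hasDerivAt_kernelCoord`,
  `landscape_rate_lower_bound`, and the monotonicity of `t ↦ ℋ(Γ(σ t)) − ∫₀ᵗ(lower bound)`).

With the exact action budget (`integral_kernelCoord_speed_sq_le`: `∫x² ≤ ρ²∫|ξ|² ≤ (4ρ²/μ²)·(h − ℋ(x₀))/(1−2γ)`) this is step (3b)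
of the no-exit lemma (evidence NO-EXIT-LEMMA + ADDENDUM on the crux item).

WHAT THIS IS NOT: not NS, not E, not rung C1 — calculus bookkeeping for classical profiles.
References: P. Constantin, M. Ignatova, V. Vicol, arXiv:2602.17570 (2026), §3.4.3 (3.29)–(3.31) [ConstantinIgnatovaVicol2026Putative].
-/

noncomputable section

-- flat `Theorems/<Route><Decl>…` files of one crux share the namespace of the crux (tree convention)
set_option linter.dupNamespace false

open Set Filter Topology Metric Function InnerProductSpace MeasureTheory
open scoped RealInnerProductSpace NNReal Interval

namespace Summit.NavierStokesRegularity.NavierStokesRegularity.Theorems.PowerGaugeEulerLiouville.NodalContinuum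

open Literature.Analysis Literature.Analysis.FluidPDE Literature.Analysis.ODE
open Summit.NavierStokesRegularity.NavierStokesRegularity.Theorems.PowerGaugeEulerLiouville.NodalFiniteness

variable {γ : ℝ} {c : EuclideanSpace ℝ (Fin 3)}
  {U : EuclideanSpace ℝ (Fin 3) → EuclideanSpace ℝ (Fin 3)} {P : EuclideanSpace ℝ (Fin 3) → ℝ}

/-- **Integrated landscape inequality along a backward trajectory.**  See the module docstring.
[cite: ConstantinIgnatovaVicol2026Putative, §3.4.3 eq. (3.29)–(3.31) (projected Bernoulli monotonicity; not in print)] -/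
theorem selfSimilarBernoulli_graph_gain (h : IsSelfSimilarEulerProfile γ c U P) (hγ2 : γ < 1 / 2)
    {z e : EuclideanSpace ℝ (Fin 3)} (hΩz : curl U z = 0) (he : ‖e‖ = 1)
    {g g' : ℝ → EuclideanSpace ℝ (Fin 3)} (hge : ∀ τ, ⟪e, g τ⟫ = 0) (hgd : ∀ τ, HasDerivAt g (g' τ) τ)
    {φ : ℝ → ℝ} (hφc : Continuous φ) {δ : ℝ}
    (hpar : ∀ τ, |τ| ≤ δ → selfSimilarTransport γ c U (z + τ • e + g τ) = φ τ • e)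
    (hθ : ∀ τ, |τ| ≤ δ → 2 * ‖fderiv ℝ U (z + τ • e + g τ) - fderiv ℝ U z‖ * ‖e + g' τ‖ ≤ (1 - 2 * γ) / 2)
    {Y : ℝ → EuclideanSpace ℝ (Fin 3)}
    (hY : ∀ t, HasDerivAt Y ((-1 : ℝ) • selfSimilarTransport γ c U (Y t)) t) {t₁ : ℝ} (ht₁ : 0 ≤ t₁)
    (hσ : ∀ t ∈ Icc 0 t₁, |⟪e, Y t - z⟫| ≤ δ) :
    ∫ t in (0 : ℝ)..t₁, ((1 - 2 * γ) / 4 * φ ⟪e, Y t - z⟫ ^ 2 -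
        3 * (1 - 2 * γ) / 4 * (⟪e, selfSimilarTransport γ c U (Y t)⟫ - φ ⟪e, Y t - z⟫) ^ 2) ≤
      selfSimilarBernoulli γ c U P (z + ⟪e, Y t₁ - z⟫ • e + g ⟪e, Y t₁ - z⟫) -
        selfSimilarBernoulli γ c U P (z + ⟪e, Y 0 - z⟫ • e + g ⟪e, Y 0 - z⟫) := by
  set V := selfSimilarTransport γ c U with hV
  set Hb := selfSimilarBernoulli γ c U P with hHb
  set σ : ℝ → ℝ := fun t => ⟪e, Y t - z⟫ with hσdef
  set F : ℝ → ℝ := fun t => Hb (z + σ t • e + g (σ t)) with hFdef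
  set lb : ℝ → ℝ := fun t => (1 - 2 * γ) / 4 * φ (σ t) ^ 2 -
    3 * (1 - 2 * γ) / 4 * (⟪e, V (Y t)⟫ - φ (σ t)) ^ 2 with hlb
  -- continuity of the integrand
  have hYc : Continuous Y := continuous_iff_continuousAt.2 fun t => (hY t).continuousAt
  have hVc : Continuous V := by
    have e1 : V = fun y => γ • (y - c) + U y := rfl
    rw [e1]
    exact ((continuous_id.sub continuous_const).const_smul γ).add h.contDiff_velocity.continuous
  have hσc : Continuous σ := continuous_const.inner (hYc.sub continuous_const)
  have hlbc : Continuous lb :=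
    ((continuous_const.mul ((hφc.comp hσc).pow 2)).sub
      (continuous_const.mul (((continuous_const.inner (hVc.comp hYc)).sub (hφc.comp hσc)).pow 2)))
  -- the derivative of `F` and its lower bound on `[0, t₁]`
  have hσ' : ∀ t, HasDerivAt σ (-⟪e, V (Y t)⟫) t := fun t => hasDerivAt_kernelCoord (hY t) e z
  have hF' : ∀ t ∈ Icc 0 t₁, ∃ d : ℝ, HasDerivAt F d t ∧ lb t ≤ d := by
    intro t ht
    obtain ⟨θ, hθb, hder⟩ := hasDerivAt_selfSimilarBernoulli_graph h hΩz he hge (hgd (σ t))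
      (hpar (σ t) (hσ t ht))
    -- chain rule with `σ`
    have h1 := hder.scomp t (hσ' t)
    have hcomp : HasDerivAt F ((-⟪e, V (Y t)⟫) • (φ (σ t) * ((2 * γ - 1) + θ))) t := h1
    refine ⟨_, hcomp, ?_⟩
    have hθ' : |θ| ≤ (1 - 2 * γ) / 2 := hθb.trans (hθ (σ t) (hσ t ht))
    have key := landscape_rate_lower_bound (φ := φ (σ t)) (x := ⟪e, V (Y t)⟫ - φ (σ t)) hγ2 hθ'
    have e1 : -φ (σ t) - (⟪e, V (Y t)⟫ - φ (σ t)) = -⟪e, V (Y t)⟫ := by ring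
    rw [e1] at key
    have e2 : (-⟪e, V (Y t)⟫) • (φ (σ t) * ((2 * γ - 1) + θ)) =
        φ (σ t) * ((2 * γ - 1) + θ) * (-⟪e, V (Y t)⟫) := by rw [smul_eq_mul]; ring
    rw [e2]
    exact key
  -- monotonicity of `Λ t = F t - ∫₀ᵗ lb`
  set Λ : ℝ → ℝ := fun t => F t - ∫ s in (0 : ℝ)..t, lb s with hΛ
  have hint : ∀ t, HasDerivAt (fun t => ∫ s in (0 : ℝ)..t, lb s) (lb t) t := fun t =>
    (hlbc.integral_hasStrictDerivAt 0 t).hasDerivAt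
  have hmono : MonotoneOn Λ (Icc 0 t₁) := by
    refine monotoneOn_of_hasDerivWithinAt_nonneg (convex_Icc 0 t₁) (f' := fun t =>
      Classical.choose (show ∃ d : ℝ, (t ∈ Icc 0 t₁ → HasDerivAt F d t ∧ lb t ≤ d) from by
        by_cases ht : t ∈ Icc 0 t₁
        · obtain ⟨d, hd⟩ := hF' t ht; exact ⟨d, fun _ => hd⟩
        · exact ⟨0, fun h' => absurd h' ht⟩) - lb t) ?_ ?_ ?_
    · intro t ht
      have hspec := Classical.choose_spec (show ∃ d : ℝ, (t ∈ Icc 0 t₁ → HasDerivAt F d t ∧ lb t ≤ d) from by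
        by_cases ht' : t ∈ Icc 0 t₁
        · obtain ⟨d, hd⟩ := hF' t ht'; exact ⟨d, fun _ => hd⟩
        · exact ⟨0, fun h' => absurd h' ht'⟩) ht
      exact (hspec.1.sub (hint t)).continuousAt.continuousWithinAt
    · intro t ht
      have ht' : t ∈ Icc 0 t₁ := interior_subset ht
      have hspec := Classical.choose_spec (show ∃ d : ℝ, (t ∈ Icc 0 t₁ → HasDerivAt F d t ∧ lb t ≤ d) from by
        by_cases ht'' : t ∈ Icc 0 t₁
        · obtain ⟨d, hd⟩ := hF' t ht''; exact ⟨d, fun _ => hd⟩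
        · exact ⟨0, fun h' => absurd h' ht''⟩) ht'
      exact (hspec.1.sub (hint t)).hasDerivWithinAt
    · intro t ht
      have ht' : t ∈ Icc 0 t₁ := interior_subset ht
      have hspec := Classical.choose_spec (show ∃ d : ℝ, (t ∈ Icc 0 t₁ → HasDerivAt F d t ∧ lb t ≤ d) from by
        by_cases ht'' : t ∈ Icc 0 t₁
        · obtain ⟨d, hd⟩ := hF' t ht''; exact ⟨d, fun _ => hd⟩
        · exact ⟨0, fun h' => absurd h' ht''⟩) ht'
      linarith [hspec.2]
  have h01 := hmono (left_mem_Icc.2 ht₁) (right_mem_Icc.2 ht₁) ht₁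
  simp only [hΛ, intervalIntegral.integral_same, sub_zero] at h01
  show (∫ t in (0 : ℝ)..t₁, lb t) ≤ F t₁ - F 0
  linarith [h01]

end Summit.NavierStokesRegularity.NavierStokesRegularity.Theorems.PowerGaugeEulerLiouville.NodalContinuum
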